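import Mathlib
import HarnessLib
import Literature.Analysis.FluidPDE.KochTataru
import Literature.Analysis.FluidPDE.NSBoundedMildOseen
import Literature.Analysis.FluidPDE.OseenDuhamelLowFrequency
import Literature.Analysis.FluidPDE.FujitaKatoHeatWeights
import Summits.NavierStokesRegularity.NavierStokesRegularity.Theorems.QuarterLogPincerQuietCollarOseenHalfMoment
import Summits.NavierStokesRegularity.NavierStokesRegularity.Theorems.QuarterLogPincerQuietCollarOseenCommutatorSup
import Summits.NavierStokesRegularity.NavierStokesRegularity.Theorems.QuarterLogPincerQuietCollarOseenCommutatorDomination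
import Summits.NavierStokesRegularity.NavierStokesRegularity.Theorems.QuarterLogPincerQuietCollarOseenCommutatorYoung

/-!
# Route `QuarterLogPincer`, crux `TypeIQuantSubcubicExp` (stmt-NavierStokesRegularity-24077), line `quiet_collar` — towards QP2
# (log-weighted typing `StubCutPairLog`), module M1b-L³: THE OSEEN COMMUTATOR IN `L³`, AGAINST THE LOCAL BUDGET

With the pointwise domination of `…QuietCollarOseenCommutatorDomination`
(`‖O(t,x)‖ₑ ≤ Lχ^{1/2}∫⁻∫⁻k̃F + η_c∫⁻∫⁻kG + 1_{B(0,ρ)}(x)·Θ`), Minkowski's integral inequality in the time variable (tree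
`Literature.Analysis.FunctionSpaces.rpow_inv_lintegral_rpow_lintegral_le'`) and Young's inequality in the space variable (the
Jensen step `Literature.Analysis.UnboundedOperators.lintegral_mul_rpow_le_of_one_le`) give the `L³` clause of the Oseen half of the
mild defect WITHOUT any global `L³` information on the field and WITHOUT a `log(1/ε)`:

* (from `…QuietCollarOseenCommutatorYoung`: the `ℝ≥0∞` Young inequality and `rpow_lintegral_duhamelMajorant_le`);
* `eLpNorm_oseenCommutator_three_le` — **THE `L³` BOUND**: if moreover `‖u(τ,y)‖ ≤ M_u(1−τ)^{−1/2}` (Type-I shape, `t ≤ 1`) and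
  `‖1_{B(0,R)}u(τ)‖₃ ≤ b` on `(0,t)`, then
  `‖O(t)‖₃ ≤ C₀·(Lχ^{1/2}·M_u·b + η_c·b·t^{1/2}) + C_K A²(4π/(R−ρ))t·|B(0,ρ)|^{1/3}`
  (the commutator part: `∫₀ᵗ H(t−τ)^{−1/4}·M_u(1−τ)^{−1/2}·b dτ ≤ 4HM_u b` since `(1−τ)^{−1/2} ≤ (t−τ)^{−1/2}`; the transition
  part: `∫₀ᵗ m(t−τ)^{−1/2}η_c b dτ = 2m η_c b√t`; the far part is constant on `B(0,ρ)`).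

With the QP2 radii (`ρ = r+L`, `R ≥ 2Λ(r+L)²`, `Λ ≍ ε⁻¹`, `A = Mε^{−1/2}`) every term is `≤ C(M)·(b+1)`, uniformly in `r` and `ε`.
r-INDEPENDENT groundwork for QP2 (DIRECTOR-NS KEY-NS #187).  HONEST FRAME: kernel estimates about a hypothetical field; nothing
here bears on 24077, W7 or Navier–Stokes regularity (OPEN).  pub-ns-dss typer (g37), `--supports 24077`.
-/

noncomputable section

set_option linter.dupNamespace false

namespace Summit.NavierStokesRegularity.NavierStokesRegularity.Cruxes.TypeIQuantSubcubicExp.QuietCollar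

open MeasureTheory Set Function Filter Real Metric
open scoped ENNReal NNReal Topology
open Literature.Analysis Literature.Analysis.FluidPDE Literature.Analysis.UnboundedOperators

/-! ### The `L³` bound of the Oseen commutator -/

/-- `(∫⁻ (1_s c)^3)^{1/3} = c·|s|^{1/3}` for the indicator of a measurable set. [folklore] -/
theorem rpow_lintegral_indicator_const_rpow {s : Set (EuclideanSpace ℝ (Fin 3))} (hs : MeasurableSet s) (c : ℝ≥0∞) :
    (∫⁻ x, (s.indicator (fun _ => c) x) ^ (3 : ℝ)) ^ (1 / (3 : ℝ)) = c * volume s ^ (1 / (3 : ℝ)) := by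
  have h : (fun x => (s.indicator (fun _ => c) x) ^ (3 : ℝ)) = s.indicator (fun _ => c ^ (3 : ℝ)) := by
    funext x
    by_cases hx : x ∈ s
    · simp [Set.indicator_of_mem hx]
    · simp [Set.indicator_of_notMem hx]
  rw [h, lintegral_indicator_const hs, rpow_mul_rpow_inv (by norm_num)]

/-- `(∫⁻ (c·f)^3)^{1/3} = c·(∫⁻ f^3)^{1/3}` for a constant `c ≠ ∞`. [folklore] -/
theorem rpow_lintegral_const_mul_rpow {f : EuclideanSpace ℝ (Fin 3) → ℝ≥0∞} {c : ℝ≥0∞} (hc : c ≠ ⊤) :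
    (∫⁻ x, (c * f x) ^ (3 : ℝ)) ^ (1 / (3 : ℝ)) = c * (∫⁻ x, f x ^ (3 : ℝ)) ^ (1 / (3 : ℝ)) := by
  have h : (fun x => (c * f x) ^ (3 : ℝ)) = fun x => c ^ (3 : ℝ) * f x ^ (3 : ℝ) := by
    funext x; exact ENNReal.mul_rpow_of_nonneg _ _ (by norm_num)
  rw [h, lintegral_const_mul' _ _ (ENNReal.rpow_ne_top_of_nonneg (by norm_num) hc), rpow_mul_rpow_inv (by norm_num)]

/-- `∫⁻_{(0,t)} (t−τ)^{−3/4} dτ = 4·t^{1/4}` (`t > 0`). [folklore] -/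
theorem setLIntegral_Ioo_sub_rpow_neg_three_quarters {t : ℝ} (ht : 0 < t) :
    ∫⁻ τ in Ioo 0 t, ENNReal.ofReal ((t - τ) ^ (-(3 / 4 : ℝ))) = ENNReal.ofReal (t ^ (1 / 4 : ℝ) / (1 / 4 : ℝ)) := by
  have h := FujitaKato.lintegral_Ioc_sub_rpow (p := -(3 / 4 : ℝ)) (h := t) (t := t) (by norm_num) ht.le
  rw [sub_self] at h
  rw [restrict_Ioo_eq_restrict_Ioc, h]
  norm_num

/-- **THE OSEEN COMMUTATOR IN `L³`, AGAINST THE LOCAL BUDGET**: there is an absolute `C₀ > 0` such that for `0 < t ≤ 1`, a weight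
`χ` (measurable, `0 ≤ χ ≤ 1`, `Lχ`-Lipschitz, `χ = 0` off `B(0,ρ)`, `ρ < R`), and a field `u` measurable on `(0,t) × ℝ³` with
`‖u(τ,y)‖ ≤ A`, the TYPE-I SHAPE `‖u(τ,y)‖ ≤ M_u(1−τ)^{−1/2}`, `‖u(τ,y)‖ ≤ η_c` where `0 < χ(y) < 1`, and the LOCAL `L³` budget
`‖1_{B(0,R)}u(τ)‖₃ ≤ b` on `(0,t)`:
`‖χ·B₀(u,u)(t) − B₀(χu,χu)(t)‖_{L³} ≤ C₀·(Lχ^{1/2}·M_u·b + η_c·b) + C_K·A²·(4π/(R−ρ))·t·|B(0,ρ)|^{1/3}`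
— no `log(1/(1−t))`: the commutator part integrates `(t−τ)^{−1/4}(1−τ)^{−1/2} ≤ (t−τ)^{−3/4}`. [folklore] -/
theorem eLpNorm_oseenCommutator_three_le :
    ∃ C₀ : ℝ, 0 < C₀ ∧ ∀ (u : ℝ → EuclideanSpace ℝ (Fin 3) → EuclideanSpace ℝ (Fin 3)) (χ : EuclideanSpace ℝ (Fin 3) → ℝ)
      (t Lχ A Mu ηc ρ R b : ℝ), 0 < t → t ≤ 1 → Measurable χ → (∀ z, 0 ≤ χ z) → (∀ z, χ z ≤ 1) → 0 ≤ Lχ →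
      (∀ x y, |χ x - χ y| ≤ Lχ * ‖x - y‖) → (∀ z : EuclideanSpace ℝ (Fin 3), ρ ≤ ‖z‖ → χ z = 0) → ρ < R →
      AEStronglyMeasurable (uncurry u) (volume.restrict (Ioo 0 t ×ˢ univ)) →
      (∀ τ ∈ Ioo 0 t, ∀ y, ‖u τ y‖ ≤ A) → 0 ≤ Mu →
      (∀ τ ∈ Ioo 0 t, ∀ y, ‖u τ y‖ ≤ Mu * (1 - τ) ^ (-(1 / 2 : ℝ))) → 0 ≤ ηc →
      (∀ τ ∈ Ioo 0 t, ∀ y, 0 < χ y → χ y < 1 → ‖u τ y‖ ≤ ηc) → 0 ≤ b →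
      (∀ τ ∈ Ioo 0 t, eLpNorm ((Metric.ball (0 : EuclideanSpace ℝ (Fin 3)) R).indicator (u τ)) 3 volume ≤ ENNReal.ofReal b) →
      eLpNorm (fun x => χ x • oseenDuhamel 1 0 u u t x -
          oseenDuhamel 1 0 (fun τ y => χ y • u τ y) (fun τ y => χ y • u τ y) t x) 3 volume ≤
        ENNReal.ofReal (C₀ * (Lχ ^ (1 / 2 : ℝ) * Mu * b + ηc * b)) +
          ENNReal.ofReal (oseenKernelBoundConst (EuclideanSpace ℝ (Fin 3)) * A ^ 2 * (4 * Real.pi / (R - ρ)) * t) *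
            volume (Metric.ball (0 : EuclideanSpace ℝ (Fin 3)) ρ) ^ (1 / (3 : ℝ)) := by
  set H : ℝ := oseenKernelBoundConst (EuclideanSpace ℝ (Fin 3)) *
    ∫ w : EuclideanSpace ℝ (Fin 3), (1 + ‖w‖ ^ 2) ^ (-(2 : ℝ)) * ‖w‖ ^ (1 / 2 : ℝ) with hH
  have hHpos : 0 < H := halfMomentConst_pos
  set m : ℝ := oseenMajorantMass (EuclideanSpace ℝ (Fin 3)) with hm
  have hmpos : 0 < m := oseenMajorantMass_pos
  refine ⟨4 * H + 2 * m, by positivity, ?_⟩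
  intro u χ t Lχ A Mu ηc ρ R b ht ht1 hχm h0 h1 hL hLip hχρ hρR hu huA hMu huM hηc hquiet hb hbud
  set ν : Measure ℝ := volume.restrict (Ioo 0 t) with hν
  set μ : Measure (ℝ × EuclideanSpace ℝ (Fin 3)) := ν.prod volume with hμ
  have hu' : AEStronglyMeasurable (uncurry u) μ := by
    rw [hμ, hν, Measure.restrict_prod_eq_prod_univ, ← Measure.volume_eq_prod]; exact hu
  -- the two localised fields and their slab measurability
  set Φ₁ : ℝ → EuclideanSpace ℝ (Fin 3) → ℝ := fun τ y =>
    (Metric.ball (0 : EuclideanSpace ℝ (Fin 3)) R).indicator (fun y => ‖u τ y‖ ^ 2) y with hΦ₁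
  set Φ₂ : ℝ → EuclideanSpace ℝ (Fin 3) → ℝ := fun τ y =>
    (Metric.ball (0 : EuclideanSpace ℝ (Fin 3)) R).indicator (fun y => ‖u τ y‖) y with hΦ₂
  have hsetR : MeasurableSet {p : ℝ × EuclideanSpace ℝ (Fin 3) | p.2 ∈ Metric.ball (0 : EuclideanSpace ℝ (Fin 3)) R} :=
    measurableSet_ball.preimage measurable_snd
  have hΦ₁eq : uncurry Φ₁ = {p : ℝ × EuclideanSpace ℝ (Fin 3) | p.2 ∈ Metric.ball (0 : EuclideanSpace ℝ (Fin 3)) R}.indicator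
      (fun p => ‖uncurry u p‖ ^ 2) := by
    funext p
    change (Metric.ball (0 : EuclideanSpace ℝ (Fin 3)) R).indicator (fun y => ‖u p.1 y‖ ^ 2) p.2 = _
    by_cases hp : p.2 ∈ Metric.ball (0 : EuclideanSpace ℝ (Fin 3)) R
    · rw [Set.indicator_of_mem hp,
        Set.indicator_of_mem (show p ∈ {q : ℝ × EuclideanSpace ℝ (Fin 3) | q.2 ∈ Metric.ball (0 : EuclideanSpace ℝ (Fin 3)) R}
          from hp)]
      rfl
    · rw [Set.indicator_of_notMem hp,
        Set.indicator_of_notMem (show p ∉ {q : ℝ × EuclideanSpace ℝ (Fin 3) | q.2 ∈ Metric.ball (0 : EuclideanSpace ℝ (Fin 3)) R}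
          from hp)]
  have hΦ₂eq : uncurry Φ₂ = {p : ℝ × EuclideanSpace ℝ (Fin 3) | p.2 ∈ Metric.ball (0 : EuclideanSpace ℝ (Fin 3)) R}.indicator
      (fun p => ‖uncurry u p‖) := by
    funext p
    change (Metric.ball (0 : EuclideanSpace ℝ (Fin 3)) R).indicator (fun y => ‖u p.1 y‖) p.2 = _
    by_cases hp : p.2 ∈ Metric.ball (0 : EuclideanSpace ℝ (Fin 3)) R
    · rw [Set.indicator_of_mem hp,
        Set.indicator_of_mem (show p ∈ {q : ℝ × EuclideanSpace ℝ (Fin 3) | q.2 ∈ Metric.ball (0 : EuclideanSpace ℝ (Fin 3)) R}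
          from hp)]
      rfl
    · rw [Set.indicator_of_notMem hp,
        Set.indicator_of_notMem (show p ∉ {q : ℝ × EuclideanSpace ℝ (Fin 3) | q.2 ∈ Metric.ball (0 : EuclideanSpace ℝ (Fin 3)) R}
          from hp)]
  have hΦ₁m : AEStronglyMeasurable (uncurry Φ₁) (volume.restrict (Ioo 0 t ×ˢ univ)) := by
    rw [hΦ₁eq]; exact ((hu.norm.pow 2).indicator hsetR)
  have hΦ₂m : AEStronglyMeasurable (uncurry Φ₂) (volume.restrict (Ioo 0 t ×ˢ univ)) := by
    rw [hΦ₂eq]; exact (hu.norm.indicator hsetR)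
  have hΦ₁0 : ∀ τ y, 0 ≤ Φ₁ τ y := fun τ y => Set.indicator_nonneg (fun _ _ => by positivity) _
  have hΦ₂0 : ∀ τ y, 0 ≤ Φ₂ τ y := fun τ y => Set.indicator_nonneg (fun _ _ => norm_nonneg _) _
  -- slice `L³` bounds of the localised fields
  have hΦ₂L3 : ∀ τ ∈ Ioo 0 t, eLpNorm (Φ₂ τ) 3 volume ≤ ENNReal.ofReal b := by
    intro τ hτ
    have heq : Φ₂ τ = fun y => ‖(Metric.ball (0 : EuclideanSpace ℝ (Fin 3)) R).indicator (u τ) y‖ := by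
      funext y; simp only [hΦ₂, norm_indicator_eq_indicator_norm]
    rw [heq, eLpNorm_norm]; exact hbud τ hτ
  have hΦ₁L3 : ∀ τ ∈ Ioo 0 t, eLpNorm (Φ₁ τ) 3 volume ≤ ENNReal.ofReal (Mu * (1 - τ) ^ (-(1 / 2 : ℝ))) * ENNReal.ofReal b := by
    intro τ hτ
    have hle : ∀ y, ‖Φ₁ τ y‖ ≤ Mu * (1 - τ) ^ (-(1 / 2 : ℝ)) * ‖(Metric.ball (0 : EuclideanSpace ℝ (Fin 3)) R).indicator (u τ) y‖ := by
      intro y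
      by_cases hy : y ∈ Metric.ball (0 : EuclideanSpace ℝ (Fin 3)) R
      · simp only [hΦ₁, Set.indicator_of_mem hy]
        rw [Real.norm_of_nonneg (sq_nonneg _), sq]
        exact mul_le_mul_of_nonneg_right (huM τ hτ y) (norm_nonneg _)
      · simp only [hΦ₁, Set.indicator_of_notMem hy, norm_zero, mul_zero, le_rfl]
    exact (eLpNorm_le_mul_eLpNorm_of_ae_le_mul (Eventually.of_forall hle) 3).trans (mul_le_mul' le_rfl (hbud τ hτ))
  -- the kernels on `ℝ × ℝ³` (nonnegative everywhere via `|σ|`)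
  set κ₁ : ℝ × EuclideanSpace ℝ (Fin 3) → ℝ := fun q =>
    oseenMajorant (EuclideanSpace ℝ (Fin 3)) |q.1| q.2 * ‖q.2‖ ^ (1 / 2 : ℝ) with hκ₁
  set κ₂ : ℝ × EuclideanSpace ℝ (Fin 3) → ℝ := fun q => oseenMajorant (EuclideanSpace ℝ (Fin 3)) |q.1| q.2 with hκ₂
  have hκm : Measurable fun q : ℝ × EuclideanSpace ℝ (Fin 3) => oseenMajorant (EuclideanSpace ℝ (Fin 3)) |q.1| q.2 :=
    measurable_oseenMajorant_uncurry.comp ((measurable_fst.abs).prodMk measurable_snd)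
  have hκ₁m : Measurable κ₁ := hκm.mul (measurable_snd.norm.pow_const _)
  have hκ₂m : Measurable κ₂ := hκm
  have hκ₁0 : ∀ q, 0 ≤ κ₁ q := fun q => mul_nonneg (oseenMajorant_nonneg (abs_nonneg _) _) (Real.rpow_nonneg (norm_nonneg _) _)
  have hκ₂0 : ∀ q, 0 ≤ κ₂ q := fun q => oseenMajorant_nonneg (abs_nonneg _) _
  have hκ₁1 : ∀ σ, 0 < σ → ∫⁻ z, ENNReal.ofReal (κ₁ (σ, z)) ≤ ENNReal.ofReal (H * σ ^ (-(1 / 4 : ℝ))) := by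
    intro σ hσ
    have hf : (fun z => κ₁ (σ, z)) = fun z => oseenMajorant (EuclideanSpace ℝ (Fin 3)) σ z * ‖z‖ ^ (1 / 2 : ℝ) := by
      funext z; simp only [hκ₁, abs_of_pos hσ]
    refine le_of_eq ?_
    rw [show (fun z => ENNReal.ofReal (κ₁ (σ, z))) = fun z => ENNReal.ofReal ((fun z => κ₁ (σ, z)) z) from rfl, hf,
      ← ofReal_integral_eq_lintegral_ofReal (integrable_oseenMajorant_mul_sqrt_norm hσ)
        (Eventually.of_forall fun z => mul_nonneg (oseenMajorant_nonneg hσ.le _) (Real.rpow_nonneg (norm_nonneg _) _)),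
      integral_oseenMajorant_mul_sqrt_norm hσ, hH]
  have hκ₂1 : ∀ σ, 0 < σ → ∫⁻ z, ENNReal.ofReal (κ₂ (σ, z)) ≤ ENNReal.ofReal (m * σ ^ (-(1 / 2 : ℝ))) := by
    intro σ hσ
    have hf : (fun z => κ₂ (σ, z)) = fun z => oseenMajorant (EuclideanSpace ℝ (Fin 3)) σ z := by
      funext z; simp only [hκ₂, abs_of_pos hσ]
    refine le_of_eq ?_
    rw [show (fun z => ENNReal.ofReal (κ₂ (σ, z))) = fun z => ENNReal.ofReal ((fun z => κ₂ (σ, z)) z) from rfl, hf,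
      ← ofReal_integral_eq_lintegral_ofReal (integrable_oseenMajorant hσ)
        (Eventually.of_forall fun z => oseenMajorant_nonneg hσ.le _), integral_oseenMajorant hσ, hm]
  -- the three majorants as functions of `x`
  set I₁ : EuclideanSpace ℝ (Fin 3) → ℝ≥0∞ := fun x => ∫⁻ p, ENNReal.ofReal (κ₁ (t - p.1, x - p.2) * Φ₁ p.1 p.2) ∂μ with hI₁
  set I₂ : EuclideanSpace ℝ (Fin 3) → ℝ≥0∞ := fun x => ∫⁻ p, ENNReal.ofReal (κ₂ (t - p.1, x - p.2) * Φ₂ p.1 p.2) ∂μ with hI₂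
  set cfar : ℝ≥0∞ := ENNReal.ofReal (oseenKernelBoundConst (EuclideanSpace ℝ (Fin 3)) * A ^ 2 * (4 * Real.pi / (R - ρ)) * t)
    with hcfar
  set I₃ : EuclideanSpace ℝ (Fin 3) → ℝ≥0∞ := fun x => (Metric.ball (0 : EuclideanSpace ℝ (Fin 3)) ρ).indicator (fun _ => cfar) x
    with hI₃
  -- pointwise domination (from M1b-dom; the kernels agree with `κᵢ` a.e. on the slab)
  have hae : ∀ᵐ p ∂μ, p.1 ∈ Ioo 0 t := by
    rw [hμ, hν, Measure.restrict_prod_eq_prod_univ]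
    filter_upwards [ae_restrict_mem (measurableSet_Ioo.prod MeasurableSet.univ)] with p hp
    exact hp.1
  have hdom : ∀ x, ‖χ x • oseenDuhamel 1 0 u u t x -
      oseenDuhamel 1 0 (fun τ y => χ y • u τ y) (fun τ y => χ y • u τ y) t x‖ₑ ≤
      ENNReal.ofReal (Lχ ^ (1 / 2 : ℝ)) * I₁ x + ENNReal.ofReal ηc * I₂ x + I₃ x := by
    intro x
    have h := enorm_oseenCommutator_le_lintegral ht hχm h0 h1 hL hLip hχρ hρR hu huA hηc hquiet x
    have e1 : I₁ x = ∫⁻ p, ENNReal.ofReal (oseenMajorant (EuclideanSpace ℝ (Fin 3)) (t - p.1) (x - p.2) * ‖x - p.2‖ ^ (1 / 2 : ℝ) *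
        (Metric.ball (0 : EuclideanSpace ℝ (Fin 3)) R).indicator (fun y => ‖u p.1 y‖ ^ 2) p.2) ∂μ := by
      refine lintegral_congr_ae ?_
      filter_upwards [hae] with p hp
      simp only [hκ₁, hΦ₁, abs_of_pos (sub_pos.2 hp.2)]
    have e2 : I₂ x = ∫⁻ p, ENNReal.ofReal (oseenMajorant (EuclideanSpace ℝ (Fin 3)) (t - p.1) (x - p.2) *
        (Metric.ball (0 : EuclideanSpace ℝ (Fin 3)) R).indicator (fun y => ‖u p.1 y‖) p.2) ∂μ := by
      refine lintegral_congr_ae ?_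
      filter_upwards [hae] with p hp
      simp only [hκ₂, hΦ₂, abs_of_pos (sub_pos.2 hp.2)]
    rw [e1, e2]
    exact h
  -- measurability of the majorants in `x`
  have hF₁ : AEMeasurable (uncurry Φ₁) μ := by
    have := hΦ₁m.aemeasurable
    rwa [hμ, hν, Measure.restrict_prod_eq_prod_univ, ← Measure.volume_eq_prod]
  have hF₂ : AEMeasurable (uncurry Φ₂) μ := by
    have := hΦ₂m.aemeasurable
    rwa [hμ, hν, Measure.restrict_prod_eq_prod_univ, ← Measure.volume_eq_prod]
  have hI₁m : AEMeasurable I₁ volume := by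
    have hk : Measurable fun q : EuclideanSpace ℝ (Fin 3) × (ℝ × EuclideanSpace ℝ (Fin 3)) => κ₁ (t - q.2.1, q.1 - q.2.2) :=
      hκ₁m.comp ((measurable_const.sub (measurable_fst.comp measurable_snd)).prodMk
        (measurable_fst.sub (measurable_snd.comp measurable_snd)))
    have hΦ : AEMeasurable (fun q : EuclideanSpace ℝ (Fin 3) × (ℝ × EuclideanSpace ℝ (Fin 3)) => uncurry Φ₁ q.2)
        ((volume : Measure (EuclideanSpace ℝ (Fin 3))).prod μ) := hF₁.comp_snd
    exact ((hk.aemeasurable.mul hΦ).ennreal_ofReal).lintegral_prod_right'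
  have hI₂m : AEMeasurable I₂ volume := by
    have hk : Measurable fun q : EuclideanSpace ℝ (Fin 3) × (ℝ × EuclideanSpace ℝ (Fin 3)) => κ₂ (t - q.2.1, q.1 - q.2.2) :=
      hκ₂m.comp ((measurable_const.sub (measurable_fst.comp measurable_snd)).prodMk
        (measurable_fst.sub (measurable_snd.comp measurable_snd)))
    have hΦ : AEMeasurable (fun q : EuclideanSpace ℝ (Fin 3) × (ℝ × EuclideanSpace ℝ (Fin 3)) => uncurry Φ₂ q.2)
        ((volume : Measure (EuclideanSpace ℝ (Fin 3))).prod μ) := hF₂.comp_snd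
    exact ((hk.aemeasurable.mul hΦ).ennreal_ofReal).lintegral_prod_right'
  have hI₃m : Measurable I₃ := measurable_const.indicator measurableSet_ball
  have hJ₁m : AEMeasurable (fun x => ENNReal.ofReal (Lχ ^ (1 / 2 : ℝ)) * I₁ x) volume := hI₁m.const_mul _
  have hJ₂m : AEMeasurable (fun x => ENNReal.ofReal ηc * I₂ x) volume := hI₂m.const_mul _
  -- Minkowski + Young on `I₁`, `I₂`
  have hM₁ : (∫⁻ x, I₁ x ^ (3 : ℝ)) ^ (1 / (3 : ℝ)) ≤ ENNReal.ofReal (4 * H * Mu * b) := by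
    refine (rpow_lintegral_duhamelMajorant_le hκ₁m hκ₁0 hκ₁1 hΦ₁m hΦ₁0).trans ?_
    have hmeas : Measurable fun τ : ℝ => ENNReal.ofReal ((t - τ) ^ (-(3 / 4 : ℝ))) :=
      ((measurable_const.sub measurable_id).pow_const _).ennreal_ofReal
    calc ∫⁻ τ in Ioo 0 t, ENNReal.ofReal (H * (t - τ) ^ (-(1 / 4 : ℝ))) * eLpNorm (Φ₁ τ) 3 volume
        ≤ ∫⁻ τ in Ioo 0 t, ENNReal.ofReal (H * Mu * b) * ENNReal.ofReal ((t - τ) ^ (-(3 / 4 : ℝ))) := by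
          refine setLIntegral_mono' measurableSet_Ioo fun τ hτ => ?_
          have hσ : 0 < t - τ := sub_pos.2 hτ.2
          have h1τ : t - τ ≤ 1 - τ := by linarith
          refine (mul_le_mul' le_rfl (hΦ₁L3 τ hτ)).trans ?_
          have hq0 : 0 ≤ (t - τ) ^ (-(1 / 4 : ℝ)) := Real.rpow_nonneg hσ.le _
          have hr0 : 0 ≤ (1 - τ) ^ (-(1 / 2 : ℝ)) := Real.rpow_nonneg (by linarith) _
          have hn1 : 0 ≤ H * (t - τ) ^ (-(1 / 4 : ℝ)) := mul_nonneg hHpos.le hq0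
          have hn2 : 0 ≤ Mu * (1 - τ) ^ (-(1 / 2 : ℝ)) := mul_nonneg hMu hr0
          have hn3 : 0 ≤ H * Mu * b := by positivity
          rw [← ENNReal.ofReal_mul hn2, ← ENNReal.ofReal_mul hn1, ← ENNReal.ofReal_mul hn3]
          refine ENNReal.ofReal_le_ofReal ?_
          have hcmp : (1 - τ) ^ (-(1 / 2 : ℝ)) ≤ (t - τ) ^ (-(1 / 2 : ℝ)) :=
            Real.rpow_le_rpow_of_nonpos hσ h1τ (by norm_num)
          have hprod : (t - τ) ^ (-(1 / 4 : ℝ)) * (t - τ) ^ (-(1 / 2 : ℝ)) = (t - τ) ^ (-(3 / 4 : ℝ)) := by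
            rw [← Real.rpow_add hσ]; norm_num
          calc H * (t - τ) ^ (-(1 / 4 : ℝ)) * (Mu * (1 - τ) ^ (-(1 / 2 : ℝ)) * b)
              ≤ H * (t - τ) ^ (-(1 / 4 : ℝ)) * (Mu * (t - τ) ^ (-(1 / 2 : ℝ)) * b) := by gcongr
            _ = H * Mu * b * ((t - τ) ^ (-(1 / 4 : ℝ)) * (t - τ) ^ (-(1 / 2 : ℝ))) := by ring
            _ = H * Mu * b * (t - τ) ^ (-(3 / 4 : ℝ)) := by rw [hprod]
      _ = ENNReal.ofReal (H * Mu * b) * ENNReal.ofReal (t ^ (1 / 4 : ℝ) / (1 / 4 : ℝ)) := by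
          rw [lintegral_const_mul _ hmeas, setLIntegral_Ioo_sub_rpow_neg_three_quarters ht]
      _ ≤ ENNReal.ofReal (4 * H * Mu * b) := by
          rw [← ENNReal.ofReal_mul (by positivity)]
          refine ENNReal.ofReal_le_ofReal ?_
          have ht4 : t ^ (1 / 4 : ℝ) ≤ 1 := Real.rpow_le_one ht.le ht1 (by norm_num)
          have : 0 ≤ H * Mu * b := by positivity
          nlinarith
  have hM₂ : (∫⁻ x, I₂ x ^ (3 : ℝ)) ^ (1 / (3 : ℝ)) ≤ ENNReal.ofReal (2 * m * b) := by
    refine (rpow_lintegral_duhamelMajorant_le hκ₂m hκ₂0 hκ₂1 hΦ₂m hΦ₂0).trans ?_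
    have hmeas : Measurable fun τ : ℝ => ENNReal.ofReal ((t - τ) ^ (-(1 / 2 : ℝ))) :=
      ((measurable_const.sub measurable_id).pow_const _).ennreal_ofReal
    calc ∫⁻ τ in Ioo 0 t, ENNReal.ofReal (m * (t - τ) ^ (-(1 / 2 : ℝ))) * eLpNorm (Φ₂ τ) 3 volume
        ≤ ∫⁻ τ in Ioo 0 t, ENNReal.ofReal (m * b) * ENNReal.ofReal ((t - τ) ^ (-(1 / 2 : ℝ))) := by
          refine setLIntegral_mono' measurableSet_Ioo fun τ hτ => ?_
          have hσ : 0 < t - τ := sub_pos.2 hτ.2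
          refine (mul_le_mul' le_rfl (hΦ₂L3 τ hτ)).trans (le_of_eq ?_)
          have hn1 : 0 ≤ m * (t - τ) ^ (-(1 / 2 : ℝ)) := mul_nonneg hmpos.le (Real.rpow_nonneg hσ.le _)
          have hn2 : 0 ≤ m * b := by positivity
          rw [← ENNReal.ofReal_mul hn1, ← ENNReal.ofReal_mul hn2]
          ring_nf
      _ = ENNReal.ofReal (m * b) * ENNReal.ofReal (2 * Real.sqrt (t - 0)) := by
          rw [lintegral_const_mul _ hmeas, setLIntegral_Ioo_sub_rpow_neg_half_of_lt ht]
      _ ≤ ENNReal.ofReal (2 * m * b) := by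
          rw [← ENNReal.ofReal_mul (by positivity)]
          refine ENNReal.ofReal_le_ofReal ?_
          rw [sub_zero]
          have hs : Real.sqrt t ≤ 1 := by rw [show (1 : ℝ) = Real.sqrt 1 by simp]; exact Real.sqrt_le_sqrt ht1
          have : 0 ≤ m * b := by positivity
          nlinarith
  -- assemble: `‖O‖₃ ≤ ‖c₁I₁‖₃ + ‖c₂I₂‖₃ + ‖I₃‖₃`
  have h3 : (1 : ℝ) ≤ 3 := by norm_num
  have hsum := calc (∫⁻ x, (ENNReal.ofReal (Lχ ^ (1 / 2 : ℝ)) * I₁ x + ENNReal.ofReal ηc * I₂ x + I₃ x) ^ (3 : ℝ)) ^ (1 / (3 : ℝ))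
      ≤ (∫⁻ x, (ENNReal.ofReal (Lχ ^ (1 / 2 : ℝ)) * I₁ x + ENNReal.ofReal ηc * I₂ x) ^ (3 : ℝ)) ^ (1 / (3 : ℝ)) +
          (∫⁻ x, I₃ x ^ (3 : ℝ)) ^ (1 / (3 : ℝ)) := ENNReal.lintegral_Lp_add_le (hJ₁m.add hJ₂m) hI₃m.aemeasurable h3
    _ ≤ (∫⁻ x, (ENNReal.ofReal (Lχ ^ (1 / 2 : ℝ)) * I₁ x) ^ (3 : ℝ)) ^ (1 / (3 : ℝ)) +
          (∫⁻ x, (ENNReal.ofReal ηc * I₂ x) ^ (3 : ℝ)) ^ (1 / (3 : ℝ)) + (∫⁻ x, I₃ x ^ (3 : ℝ)) ^ (1 / (3 : ℝ)) :=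
        add_le_add (ENNReal.lintegral_Lp_add_le hJ₁m hJ₂m h3) le_rfl
    _ = ENNReal.ofReal (Lχ ^ (1 / 2 : ℝ)) * (∫⁻ x, I₁ x ^ (3 : ℝ)) ^ (1 / (3 : ℝ)) +
          ENNReal.ofReal ηc * (∫⁻ x, I₂ x ^ (3 : ℝ)) ^ (1 / (3 : ℝ)) +
          cfar * volume (Metric.ball (0 : EuclideanSpace ℝ (Fin 3)) ρ) ^ (1 / (3 : ℝ)) := by
        rw [rpow_lintegral_const_mul_rpow ENNReal.ofReal_ne_top, rpow_lintegral_const_mul_rpow ENNReal.ofReal_ne_top, hI₃,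
          rpow_lintegral_indicator_const_rpow measurableSet_ball]
    _ ≤ ENNReal.ofReal (Lχ ^ (1 / 2 : ℝ)) * ENNReal.ofReal (4 * H * Mu * b) + ENNReal.ofReal ηc * ENNReal.ofReal (2 * m * b) +
          cfar * volume (Metric.ball (0 : EuclideanSpace ℝ (Fin 3)) ρ) ^ (1 / (3 : ℝ)) := by
        gcongr
    _ = ENNReal.ofReal (Lχ ^ (1 / 2 : ℝ) * (4 * H * Mu * b) + ηc * (2 * m * b)) +
          cfar * volume (Metric.ball (0 : EuclideanSpace ℝ (Fin 3)) ρ) ^ (1 / (3 : ℝ)) := by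
        rw [← ENNReal.ofReal_mul (Real.rpow_nonneg hL _), ← ENNReal.ofReal_mul hηc,
          ← ENNReal.ofReal_add (by positivity) (by positivity)]
    _ ≤ ENNReal.ofReal ((4 * H + 2 * m) * (Lχ ^ (1 / 2 : ℝ) * Mu * b + ηc * b)) +
          cfar * volume (Metric.ball (0 : EuclideanSpace ℝ (Fin 3)) ρ) ^ (1 / (3 : ℝ)) := by
        gcongr
        have h1' : 0 ≤ Lχ ^ (1 / 2 : ℝ) * Mu * b := by positivity
        have h2' : 0 ≤ ηc * b := by positivity
        nlinarith
  -- `‖O‖₃` is dominated by the left end of `hsum`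
  rw [eLpNorm_eq_lintegral_rpow_enorm_toReal (by norm_num) (by norm_num)]
  simp only [ENNReal.toReal_ofNat]
  refine le_trans ?_ hsum
  exact ENNReal.rpow_le_rpow (lintegral_mono fun x => ENNReal.rpow_le_rpow (hdom x) (by norm_num)) (by norm_num)

end Summit.NavierStokesRegularity.NavierStokesRegularity.Cruxes.TypeIQuantSubcubicExp.QuietCollar

end
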